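import Summits.PneNP.PneNP.Theses.RamseyUncertifiable
import Summits.PneNP.PneNP.Theorems.RamseyUncertifiableSosUncertaintyDefs
import Summits.PneNP.PneNP.Theorems.RamseyUncertifiableSosUncertaintyStrongDuality
import Summits.PneNP.PneNP.Theorems.RamseyUncertifiableSosUncertaintyHadamardBessel
import Summits.PneNP.PneNP.Theorems.RamseyUncertifiableSosUncertaintyLevelOneOrthogonal

/-!
# Skeleton line `hadamard-bessel-defect` for crux `SosUncertainty` (stmt-PneNP-9815)

Route `PneNP/RamseyUncertifiable`; crux decl
`Summit.PneNP.PneNP.Theses.RamseyUncertifiable.SosUncertainty` (UP_t):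
`∀ t ≥ 1, ∃ δ > 0, ∃ n₀, ∀ n ≥ n₀, ∀ G : SimpleGraph (Fin n), n^δ ≤ las_t(G)·las_t(Gᶜ)`
(`lasserreStableBound`, Laurent's program (22)). Idea card
`Cruxes/SosUncertainty/Ideas/hadamard-bessel-defect.md` (ideator 3; triage r1: pass ×3, "state HB
EXISTENTIALLY over certificate pairs").

THE LINE (dual side only; no pseudo-moment is ever constructed). A level-`t` SoS CERTIFICATE that
`Σ_v w_v y_v ≤ 1` on the level-`t` Lasserre body of `G` is a real PSD matrix `Q` indexed by
`P_t(V) = {S ⊆ V : |S| ≤ t}` (the index type of the tree's `momentMatrix`) whose UNION SUMS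
`Σ_{I ∪ J = U} Q_{IJ}` are `1` at `U = ∅`, `−w_v` at `U = {v}`, and `0` at every STABLE `U` with
`|U| ≥ 2` (free at non-stable `U`: this is the conic dual of program (22) with the redundant ideal
constraints `y_U = 0`, `U` non-stable, added — same optimum as (22) by the tree's
`IsLasserreFeasible.apply_eq_zero_of_not_isIndepSet`, different dual; triage r1-3). Weak duality
`⟨Q, M_t(y)⟩ = 1 − Σ w_v y_v ≥ 0` is PROVED below (`IsCertificate.sound`, via Mathlib's Schur product
theorem) and fixes the polarity of the definition. With Gram vectors `Q_{ST} = ⟨r_S, r_T⟩` the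
`x_v`-coefficient identity reads `w_v = −2⟨r_∅, r_v⟩ − ‖r_v‖² ≤ ⟨r_∅, r̂_v⟩² = cos²∠(r_∅, r_v)`
(AM–GM; `‖r_∅‖ = 1`), at EVERY level. Hence for two certificates — `Q` for `(G, w)`, `Q'` for
`(Gᶜ, w')` — and the SINGLETON COSINE MATRICES `C = cosMatrix Q`, `C' = cosMatrix Q'`
(`C_uv = Q_{uv}/√(Q_uu Q_vv)`), Bessel's inequality for the unit vectors `r̂_v ⊗ r̂'_v` gives the
HADAMARD–BESSEL INEQUALITY `⟨w, w'⟩ ≤ λ_max(C ⊙ C')` (STUB 2, `λ_max ≤ M` being expressed as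
`M•1 − C ⊙ C' ⪰ 0`). At level 1 the pair identities force `C_uv = 0` on non-edges of `G` and
`C'_uv = 0` on edges, so `C ⊙ C'` is a `0/1` diagonal (STUB 3: the certificate-side form of Lovász's
`ϑ(G)ϑ(Ḡ) ≥ n`, the calibration of the currency). At level `t ≥ 2` the off-diagonal DEFECT
`C_uv·C'_uv` is (free cosine) × (leakage cosine through the pair vectors `r_uv`), and the whole
crux becomes: SOME certificate pair at the canonical weights has `λ_max(C ⊙ C') ≤ n^{γ_t}`,
`γ_t < 1` (STUB 4 at `t = 2`, the first open case; STUB 5 for `t ≥ 3`); then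
`n/(las_t(G)·las_t(Gᶜ)) = ⟨w, w'⟩ ≤ n^{γ_t}`, i.e. UP_t with `δ_t = 1 − γ_t`. Certificates at the
near-canonical weights `w ≡ 1/((1+ε) las_t(G))`, `ε > 0`, exist by conic strong duality for (22)
(STUB 1, ε-form — reshaped by the line lead: no attainment/compactness is needed, the composition
lets `ε → 0`). `SosUncertainty_of` composes the five stubs (case split `t = 1 / t = 2 / t ≥ 3`,
`n₀ := max n₀ 1`, rpow algebra); no `sorry` outside the five `stub_*`.

WHY NO REGIME RESTRICTION in STUBS 4/5 (design note for refuters): any hypothesis of the shape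
"both weights `≥ n^{-η}`" with `η` chosen by the prover is EMPTY for large `n` if UP_t holds with
exponent `> 2η`, so a regime-restricted defect stub would be vacuous-iff-UP, i.e. the crux in
costume. Stubs 4/5 therefore quantify over ALL certifiable constant weight pairs `(a, b)` of every
large graph: they are genuinely STRONGER than UP_t (HB ⇒ UP by Stub 2; UP ⇏ HB), non-vacuous in the
trivial regimes (e.g. `Ē_n`: the certificate `(1/n)Σ(1 − x_v)²` has `C = I`, while the
`S_n`-invariant one has `C = J` — triage r1-1 (A), which is why the statement is `∃`, not `∀`, over
certificates), and closed under mixing with the trivial certificate `E_∅∅` (sub-canonical weights have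
the same cosine matrices), so their content is exactly the canonical pair `a = 1/las_t(G)`,
`b = 1/las_t(Gᶜ)`.

DISPROOF USED (Cruxes/SosUncertainty Disproof.lean v1–v5 of refuter-cdisprove-stmt-PneNP-9815-0, read
through its evidence notes on the item — the `run/gate/evidence` file itself is not mounted in planner
jails; no `Theorems/SosUncertainty/Negative/*` has landed, so there is nothing to import):
(a) `sosUncertainty_false_without_level_pos` — H = `1 ≤ t` is used at STUB 1 (level-0 values are
unbounded, no certificate exists) and in `cosMatrix`/`vtxEntry` (singletons are level-1 indices);
(b) `prod_bot_le_card`/`not_sosUncertainty_superlinear` (no `δ > 1`) — respected: `δ_t = 1 − γ_t ≤ 1`,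
and `γ_t ≥ 0` is forced by the diagonal of `n^γ•1 − C ⊙ C'`; (c) `level_two_product_C5_lt` /
`not_levelTwo_lovaszShape` — respected: the defect-free shape (`γ = 0`, `n₀ = 0`) is claimed ONLY at
`t = 1` (STUB 3); at `t = 2`, `C₅` with `a = b = 1/2` has `⟨w,w'⟩ = 5/4 > 1`, so every pair has
`λ_max(C ⊙ C') ≥ 5/4` and STUB 4 carries `γ` and `n₀`; (d) `delta_le_of_boundedAlphaFamily` (Alon's
`α ≤ 2` family: `δ₂ ≤ 2/3`) ⇒ `γ₂ ≥ 1/3` in STUB 4 — allowed; (v2) `not_uniformSosUncertainty_of_families`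
— respected: `γ_t`, `n₀(t)` depend on `t` (Feige-type families force `γ_t ≥ 1 − O(1/log t)`);
(v3–v5) conditioning recursion / `levelTwoCertificate_uncertainty` are upper-bound tools for a KILL
and constrain no stub here. `ledger negatives --problem PneNP`: no negative on SDP/SoS values.

Conventions: `sorry` appears ONLY inside the five `stub_*` theorems; `SosUncertainty_of` is a real
proof whose conclusion is literally the route decl (hypotheses = the name-keyed aliases
`Registered.stub_*`); `SosUncertainty_closed` is the same composition fed with the stubs; the sanity
lemma `IsCertificate.sound` (weak duality) is proved.
-/

set_option linter.dupNamespace false -- `Summit.PneNP.PneNP.…`: summit = sub-problem name (D-0017)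

namespace Summit.PneNP.PneNP.Cruxes.SosUncertainty.HadamardBesselDefect

open scoped BigOperators Matrix
open Finset Matrix Literature.Combinatorics.SimpleGraph

noncomputable section

/-! ### Vocabulary

`Idx`, `unionSum`, `IsCertificate`, `vtx`, `vtxEntry`, `cosMatrix`, `DefectBound`, `unionSum_eq_zero_of_card_lt`,
`IsCertificate.sound` now live in the tree: `Summits/PneNP/PneNP/Theorems/RamseyUncertifiableSosUncertaintyDefs.lean`
(p84882). Stubs 1–3 have LANDED (p86162 `stub_strongDuality`, p86589 `stub_hadamardBessel`, p86428
`stub_levelOneOrthogonal`) and are imported; only stubs 4–5 remain `sorry`. -/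

/-! ### The two open stub STATEMENTS (named `Prop`s; the registered `stub_*` theorems below restate them
verbatim, and `Registered.stub_*` are the name-keyed aliases used as hypotheses of `SosUncertainty_of`) -/

/-- Statement of STUB 4 — HB at level 2 (the first open case): a defect exponent `γ₂ < 1` works for
all large graphs. [conjecture of this line] -/
def LevelTwoDefect : Prop :=
  ∃ γ : ℝ, γ < 1 ∧ ∃ n₀ : ℕ, ∀ n ≥ n₀, ∀ G : SimpleGraph (Fin n), DefectBound 2 γ n G

/-- Statement of STUB 5 — HB at every level `t ≥ 3` (with `γ_t`, `n₀(t)` depending on `t`).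
[conjecture of this line] -/
def HigherLevelDefect : Prop :=
  ∀ t : ℕ, 3 ≤ t → ∃ γ : ℝ, γ < 1 ∧ ∃ n₀ : ℕ, ∀ n ≥ n₀, ∀ G : SimpleGraph (Fin n),
    DefectBound t γ n G

/-! ### The two remaining registered stubs (`sorry` lives ONLY in these two theorems; stubs 1–3 are imported theorems) -/

/-- **Stub 4 — the Hadamard–Bessel defect bound at level 2 (research; the first open case).**
`∃ γ₂ < 1, ∃ n₀, ∀ n ≥ n₀, ∀ G on Fin n`: every certifiable constant-weight pair `(a, b) ≥ 0` for
`(G, Gᶜ)` at level 2 admits certificates with `n^{γ₂}•1 − cosMatrix Q ⊙ cosMatrix Q' ⪰ 0`. At level 2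
the constraints on the pair vectors `r_uv` are explicit and complete: LEAKAGE on stable pairs
`⟨r_u,r_v⟩ = −⟨r_∅ + r_u + r_v + ½r_uv, r_uv⟩`, the stable-triple identity
`Σ_{sym}⟨r_u, r_vx⟩ + Σ_{sym}⟨r_uv, r_ux⟩ = 0` and the stable-4-set identity
`⟨r_uv,r_xy⟩ + ⟨r_ux,r_vy⟩ + ⟨r_uy,r_vx⟩ = 0` (mirrored on cliques for `Q'`); every off-diagonal
entry of `C ⊙ C'` is (free cosine) × (leakage cosine). Calibration the bound must meet: `C₅`-type
padding (`⟨w,w'⟩ = 5/4`), Alon's `α ≤ 2` family (`γ₂ ≥ 1/3`), Paley `P_q` (`⟨w,w'⟩ = q/las₂(P_q)² ≈ q^{0.1}`,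
KY22 numerics), `G(n,½)` (`⟨w,w'⟩ = n^{o(1)}`, BHKKMP); violators may be WEAKLY coherent everywhere
(`|C_uv C'_uv| ≈ n^{γ−1}` on a dense set, triage r1-1 (B)), so block/Gershgorin arguments do not
suffice — the 3- and 4-set identities must control a dense matrix of small entries. Staging suggested on
the line card: first the MIXED pair (`Q` level 2 for `G`, `Q'` LEVEL 1 for `Gᶜ` at `b = 1/ϑ(Gᶜ)`),
where `C ⊙ C'` lives on the non-edges of `G` = leakage × theta. Implies UP₂ with `δ₂ = 1 − γ₂`
(via Stubs 1, 2) and is NOT implied by it. -/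
theorem stub_levelTwoDefect :
    ∃ γ : ℝ, γ < 1 ∧ ∃ n₀ : ℕ, ∀ n ≥ n₀, ∀ G : SimpleGraph (Fin n), DefectBound 2 γ n G := by
  sorry

/-- **Stub 5 — the Hadamard–Bessel defect bound at every level `t ≥ 3` (research; hardest by
inclusion).** For each `t ≥ 3` some `γ_t < 1` and `n₀(t)`: `DefectBound t γ_t n G` for all
`G` on `n ≥ n₀(t)` vertices. `γ_t → 1` is allowed and forced: Feige-type graphs (`α < t`,
`ϑ ≥ n^{1−O(1/log t)}`, Alon–Kahale) give `⟨w,w'⟩ = n/(las_t·las_t') ≥ n^{1−O(1/log t)}/t`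
(Disproof v2 `not_uniformSosUncertainty_of_families`: no level-uniform exponent). The level-`t`
coefficient identities are the `|U| ≤ 2t` union-sum constraints on stable `U` (and on cliques for
`Q'`); the stable and clique index families meet only in `{∅} ∪ V`, which is why the whole line lives
on the singleton block. Implies UP_t for `t ≥ 3` with `δ_t = 1 − γ_t`. -/
theorem stub_higherLevelDefect :
    ∀ t : ℕ, 3 ≤ t → ∃ γ : ℝ, γ < 1 ∧ ∃ n₀ : ℕ, ∀ n ≥ n₀, ∀ G : SimpleGraph (Fin n),
      DefectBound t γ n G := by
  sorry

/-! ### Name-keyed aliases of the five statements (the hypotheses of the composition) -/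
namespace Registered

/-- Alias of `LevelTwoDefect` keyed by the registered stub name. -/
abbrev stub_levelTwoDefect : Prop := LevelTwoDefect
/-- Alias of `HigherLevelDefect` keyed by the registered stub name. -/
abbrev stub_higherLevelDefect : Prop := HigherLevelDefect

end Registered

/-! ### Composition lemmas (proved) -/

/-- `1 ≤ las_t(H)` on `n ≥ 1` vertices (`t ≥ 1`): a single vertex is a stable set. -/
theorem one_le_lasserreStableBound {n : ℕ} (hn : 1 ≤ n) (H : SimpleGraph (Fin n)) {t : ℕ}
    (ht : 1 ≤ t) : (1 : ℝ) ≤ lasserreStableBound H t := by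
  have hind : H.IsNIndepSet 1 ({(⟨0, hn⟩ : Fin n)} : Finset (Fin n)) :=
    ⟨by rw [Finset.coe_singleton]; exact Set.pairwise_singleton _ _, by simp⟩
  exact_mod_cast le_lasserreStableBound_of_isNIndepSet H t hind ht

/-- Near-canonical certificates exist (Stub 1 at the weight `1/((1+ε) las_t(H))`, since `1/las_t(H)`
is in the antiblocker by `IsLasserreFeasible.sum_singleton_le_lasserreStableBound`). -/
theorem exists_near_canonical_certificate {n t : ℕ} (ht : 1 ≤ t)
    (hn : 1 ≤ n) (H : SimpleGraph (Fin n)) {ε : ℝ} (hε : 0 < ε) :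
    ∃ Q : Matrix (Idx (Fin n) t) (Idx (Fin n) t) ℝ,
      IsCertificate H t (fun _ => (lasserreStableBound H t)⁻¹ / (1 + ε)) Q := by
  have hpos : 0 < lasserreStableBound H t :=
    lt_of_lt_of_le one_pos (one_le_lasserreStableBound hn H ht)
  refine stub_strongDuality n t ht H (fun _ => (lasserreStableBound H t)⁻¹) (fun y hy => ?_) ε hε
  show ∑ v, (lasserreStableBound H t)⁻¹ * y {v} ≤ 1
  rw [← Finset.mul_sum, inv_mul_le_iff₀ hpos, mul_one]
  exact hy.sum_singleton_le_lasserreStableBound ht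

/-- Letting `ε → 0`: if `X/(1+ε)² ≤ Y` for every `ε > 0` and `0 < Y`, then `X ≤ Y`. -/
theorem le_of_forall_div_one_add_sq_le {X Y : ℝ} (hY : 0 < Y)
    (h : ∀ ε : ℝ, 0 < ε → X / (1 + ε) ^ 2 ≤ Y) : X ≤ Y := by
  refine le_of_forall_pos_le_add fun δ hδ => ?_
  set ε := min 1 (δ / (3 * Y)) with hεdef
  have hε0 : 0 < ε := lt_min one_pos (by positivity)
  have hε1 : ε ≤ 1 := min_le_left _ _
  have hε2 : ε ≤ δ / (3 * Y) := min_le_right _ _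
  have h1 : X ≤ Y * (1 + ε) ^ 2 := by
    have h' := h ε hε0
    rwa [div_le_iff₀ (by positivity)] at h'
  have h2 : Y * (1 + ε) ^ 2 ≤ Y + 3 * Y * ε := by
    have hsq : ε ^ 2 ≤ ε := by nlinarith
    have hY' : Y * ε ^ 2 ≤ Y * ε := mul_le_mul_of_nonneg_left hsq hY.le
    nlinarith
  have h3 : 3 * Y * ε ≤ δ := by
    have := (le_div_iff₀ (by positivity : (0 : ℝ) < 3 * Y)).1 hε2
    linarith
  linarith

/-- Real-arithmetic core: `n·(A⁻¹ B⁻¹) ≤ n^γ` with `A, B > 0`, `n ≥ 1` gives `n^{1−γ} ≤ A·B`. -/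
theorem prod_ge_rpow_of_le {n : ℕ} (hn : 1 ≤ n) {A B γ : ℝ} (hA : 0 < A) (hB : 0 < B)
    (key : (n : ℝ) * (A⁻¹ * B⁻¹) ≤ (n : ℝ) ^ γ) : (n : ℝ) ^ (1 - γ) ≤ A * B := by
  have hnpos : (0 : ℝ) < n := by exact_mod_cast hn
  have hγpos : (0 : ℝ) < (n : ℝ) ^ γ := Real.rpow_pos_of_pos hnpos γ
  have hab : 0 < A * B := mul_pos hA hB
  have hA' : A ≠ 0 := hA.ne'
  have hB' : B ≠ 0 := hB.ne'
  have hid : (n : ℝ) * (A⁻¹ * B⁻¹) * (A * B) = n := by field_simp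
  have key' : (n : ℝ) ≤ (n : ℝ) ^ γ * (A * B) := by
    have := mul_le_mul_of_nonneg_right key hab.le
    rw [hid] at this
    exact this
  rw [Real.rpow_sub hnpos, Real.rpow_one, div_le_iff₀ hγpos]
  linarith [key']

/-- **UP_t for one graph from a defect bound**: Stubs 1–2 plus `DefectBound t γ n G` give
`n^{1−γ} ≤ las_t(G)·las_t(Gᶜ)` (`t, n ≥ 1`): near-canonical certificates exist for every `ε > 0`
(Stub 1), a good pair at those weights exists (`DefectBound`), Hadamard–Bessel (Stub 2) reads
`n/((1+ε)² las_t·las_t') = Σ_v a·b ≤ n^γ`, and `ε → 0`. -/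
theorem uncertainty_of_defectBound {n t : ℕ} (ht : 1 ≤ t) (hn : 1 ≤ n) (G : SimpleGraph (Fin n)) {γ : ℝ}
    (hG : DefectBound t γ n G) :
    (n : ℝ) ^ (1 - γ) ≤ lasserreStableBound G t * lasserreStableBound Gᶜ t := by
  have hA : 0 < lasserreStableBound G t :=
    lt_of_lt_of_le one_pos (one_le_lasserreStableBound hn G ht)
  have hB : 0 < lasserreStableBound Gᶜ t :=
    lt_of_lt_of_le one_pos (one_le_lasserreStableBound hn Gᶜ ht)
  have hnpos : (0 : ℝ) < n := by exact_mod_cast hn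
  have hγpos : (0 : ℝ) < (n : ℝ) ^ γ := Real.rpow_pos_of_pos hnpos γ
  have hε : ∀ ε : ℝ, 0 < ε →
      (n : ℝ) * ((lasserreStableBound G t)⁻¹ * (lasserreStableBound Gᶜ t)⁻¹) / (1 + ε) ^ 2
        ≤ (n : ℝ) ^ γ := by
    intro ε hε
    have ha : 0 ≤ (lasserreStableBound G t)⁻¹ / (1 + ε) := by positivity
    have hb : 0 ≤ (lasserreStableBound Gᶜ t)⁻¹ / (1 + ε) := by positivity
    obtain ⟨Q, Q', hQ, hQ', hpsd⟩ := hG _ _ ha hb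
      (exists_near_canonical_certificate ht hn G hε)
      (exists_near_canonical_certificate ht hn Gᶜ hε)
    have key := stub_hadamardBessel n t G (fun _ => (lasserreStableBound G t)⁻¹ / (1 + ε))
      (fun _ => (lasserreStableBound Gᶜ t)⁻¹ / (1 + ε)) Q Q' ((n : ℝ) ^ γ) hγpos.le
      (fun _ => ha) (fun _ => hb) hQ hQ' hpsd
    have key' : (n : ℝ) * ((lasserreStableBound G t)⁻¹ / (1 + ε) *
        ((lasserreStableBound Gᶜ t)⁻¹ / (1 + ε))) ≤ (n : ℝ) ^ γ := by
      simpa [Finset.sum_const, Finset.card_univ, Fintype.card_fin, nsmul_eq_mul] using key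
    have hrw : (n : ℝ) * ((lasserreStableBound G t)⁻¹ * (lasserreStableBound Gᶜ t)⁻¹) / (1 + ε) ^ 2
        = (n : ℝ) * ((lasserreStableBound G t)⁻¹ / (1 + ε) *
          ((lasserreStableBound Gᶜ t)⁻¹ / (1 + ε))) := by
      have h1 : (1 + ε) ≠ 0 := by positivity
      field_simp
    rw [hrw]
    exact key'
  exact prod_ge_rpow_of_le hn hA hB (le_of_forall_div_one_add_sq_le hγpos hε)

/-- Level one: Stub 3 is `DefectBound 1 0` for every graph (`n^0 • 1 = 1`). -/
theorem defectBound_one (n : ℕ) (G : SimpleGraph (Fin n)) : DefectBound 1 0 n G := by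
  rintro a b _ _ ⟨Q, hQ⟩ ⟨Q', hQ'⟩
  refine ⟨Q, Q', hQ, hQ', ?_⟩
  rw [Real.rpow_zero, one_smul]
  exact stub_levelOneOrthogonal n G _ _ Q Q' hQ hQ'

/-! ### The kernel-checked composition -/

/-- **Composition.** The five stubs (three landed, two hypotheses) imply the crux BY NAME: for a level `t ≥ 1` pick the defect
exponent `γ_t < 1` and threshold from Stub 3 (`t = 1`, `γ = 0`: Lovász), Stub 4 (`t = 2`) or Stub 5
(`t ≥ 3`); set `δ_t := 1 − γ_t > 0`, `n₀ := max n₀ 1`; for `n ≥ n₀` and `G` on `Fin n`, Stub 1 gives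
certificates at the near-canonical weights `1/((1+ε)las_t(G))`, `1/((1+ε)las_t(Gᶜ))`, the defect
bound gives a good pair, Stub 2 gives `n/((1+ε)² las_t(G) las_t(Gᶜ)) ≤ n^{γ_t}`, and `ε → 0`.
No `sorry`. -/
theorem SosUncertainty_of
    (hTwo : Registered.stub_levelTwoDefect) (hHigh : Registered.stub_higherLevelDefect) :
    Summit.PneNP.PneNP.Theses.RamseyUncertifiable.SosUncertainty := by
  intro t ht
  -- a defect exponent `γ < 1` with a threshold, for this level
  have hlevel : ∃ γ : ℝ, γ < 1 ∧ ∃ n₀ : ℕ, ∀ n ≥ n₀, ∀ G : SimpleGraph (Fin n),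
      DefectBound t γ n G := by
    rcases Nat.lt_or_ge t 2 with h2 | h2
    · obtain rfl : t = 1 := by omega
      exact ⟨0, by norm_num, 0, fun n _ G => defectBound_one n G⟩
    rcases Nat.lt_or_ge t 3 with h3 | h3
    · obtain rfl : t = 2 := by omega
      exact hTwo
    · exact hHigh t h3
  obtain ⟨γ, hγ, n₀, H⟩ := hlevel
  refine ⟨1 - γ, by linarith, max n₀ 1, fun n hn G => ?_⟩
  exact uncertainty_of_defectBound ht (le_trans (le_max_right _ _) hn) G
    (H n (le_trans (le_max_left _ _) hn) G)

/-- **`SosUncertainty_closed`** — the same composition as a CLOSED term (the crux modulo the two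
remaining `stub_*` sorries): the registered stubs, stated verbatim, are definitionally the named
statements and feed `SosUncertainty_of`. When stubs 4–5 land, this is the sorry-free proof to propose
with `--workitem stmt-PneNP-9815`. -/
theorem SosUncertainty_closed : Summit.PneNP.PneNP.Theses.RamseyUncertifiable.SosUncertainty :=
  SosUncertainty_of stub_levelTwoDefect stub_higherLevelDefect

end

end Summit.PneNP.PneNP.Cruxes.SosUncertainty.HadamardBesselDefect
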